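import Summits.QuantumFields.YangMills.Theses.ConvexGribovBody
import Literature.MathematicalPhysics.QuantumFieldTheory.LatticeGaugeProofs

/-!
# One-slice retention from the slice hypothesis and a smooth witness
(crux `ConvexGribovBody.PoincareToGap`, line `Sketch`, stub L1)

Torus `(ℤ/(2S+1))⁴`, time = coordinate `0`, Wilson state `μ = wilsonMeasure r.ρ β` (a
probability measure), one time slice `s : ℤ/(2S+1)` with spatial links
`X_s := {e | (e.1 0 - s).val = 0 ∧ e.2 ≠ 0}` and complement `O_s`, the one-slice Dirichlet form
`dir_s f := Σ_{e ∈ X_s} ∫ (slope_e f)² dμ` and the projection `P_O F := E_μ[F | links of O_s]`.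

`stub_retention_of_smoothWitness`: IF every gauge-invariant link-Lipschitz `f` reading only
`X_s` satisfies the slice Poincaré inequality `Var f ≤ κ · dir_s f`, and every bounded measurable
gauge-invariant `F` reading only `X_s` has an admissible witness `F₁` (bounded measurable,
gauge-invariant, reading only `X_s`, link-Lipschitz) with
`dir_s F₁ / β + ∫ (F - F₁)² ≤ C · ∫ (F - P_O F)²`, THEN every such `F` retains its variance:
`Var F ≤ 2 · max(κβ, 1) · C · ∫ (F - P_O F)²`.

Proof (pure `L²` algebra on a probability space; `dir_s F₁ =: D ≥ 0` is a finite sum of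
integrals of squares and is never unfolded).  With the witness `F₁` of `F`:
* `Var F ≤ 2 Var F₁ + 2 Var (F - F₁)` — pointwise `(x + y)² ≤ 2x² + 2y²` with
  `F - ∫F = (F₁ - ∫F₁) + ((F - F₁) - ∫(F - F₁))` (`var_le_two_mul_add`);
* `Var (F - F₁) = ∫ (F - F₁)² - (∫ (F - F₁))² ≤ ∫ (F - F₁)²` (`integral_sub_average_sq_le`);
* `Var F₁ ≤ κ D = (κβ)(D/β) ≤ max(κβ,1) · D/β` (`D/β ≥ 0`) and
  `∫ (F - F₁)² ≤ max(κβ,1) ∫ (F - F₁)²`;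
* sum: `Var F ≤ 2 max(κβ,1) (D/β + ∫ (F - F₁)²) ≤ 2 max(κβ,1) · C · ∫ (F - P_O F)²`
  (`retention_arith`).
All functions are bounded and measurable on a probability space, hence in `L²`
(`MemLp.of_bound`, `isProbabilityMeasure_wilsonMeasure`).

References: folklore (the `K`-functional form of "smooth cylinder functions are dense in the
Dirichlet domain"; elementary variance inequalities).
-/

noncomputable section

open scoped BigOperators Topology
open MeasureTheory Filter
open Literature.MathematicalPhysics.QuantumFieldTheory

namespace Summit.QuantumFields.YangMills.Theorems.PoincareToGap

/-! ### Elementary `L²` facts on a probability space -/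

/-- On a probability space, `∫ (f - ∫ f)² = ∫ f² - (∫ f)²` for `f ∈ L²`. [folklore] -/
private theorem integral_sub_average_sq_eq {Ω : Type*} [MeasurableSpace Ω] {μ : Measure Ω}
    [IsProbabilityMeasure μ] {f : Ω → ℝ} (hf : MemLp f 2 μ) :
    ∫ x, (f x - ∫ y, f y ∂μ) ^ 2 ∂μ = ∫ x, f x ^ 2 ∂μ - (∫ y, f y ∂μ) ^ 2 := by
  -- adapted from `ConvexGribovBodyPoincareToGapSliceCovSum.lean` (private there)
  set c := ∫ y, f y ∂μ with hc
  have hi : Integrable f μ := hf.integrable one_le_two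
  have e : ∀ x, (f x - c) ^ 2 = (f x ^ 2 - (2 * c) * f x) + c ^ 2 := fun x => by ring
  have i1 : Integrable (fun x => f x ^ 2 - (2 * c) * f x) μ :=
    hf.integrable_sq.sub (hi.const_mul _)
  simp_rw [e]
  rw [integral_add i1 (integrable_const _), integral_sub hf.integrable_sq (hi.const_mul _),
    integral_const_mul, integral_const, probReal_univ, one_smul, ← hc]
  ring

/-- The variance is at most the second moment: `∫ (g - ∫ g)² ≤ ∫ g²` for `g ∈ L²` on a
probability space. [folklore] -/
private theorem integral_sub_average_sq_le {Ω : Type*} [MeasurableSpace Ω] {μ : Measure Ω}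
    [IsProbabilityMeasure μ] {g : Ω → ℝ} (hg : MemLp g 2 μ) :
    ∫ x, (g x - ∫ y, g y ∂μ) ^ 2 ∂μ ≤ ∫ x, g x ^ 2 ∂μ := by
  rw [integral_sub_average_sq_eq hg]
  nlinarith [sq_nonneg (∫ y, g y ∂μ)]

/-- `Var F ≤ 2 Var F₁ + 2 ∫ (F - F₁)²` for `F, F₁ ∈ L²` on a probability space: pointwise
`(x + y)² ≤ 2 x² + 2 y²` with `F - ∫F = (F₁ - ∫F₁) + ((F - F₁) - ∫(F - F₁))`, then
`Var (F - F₁) ≤ ∫ (F - F₁)²`. [folklore] -/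
private theorem var_le_two_mul_add {Ω : Type*} [MeasurableSpace Ω] {μ : Measure Ω}
    [IsProbabilityMeasure μ] {F F₁ : Ω → ℝ} (hF : MemLp F 2 μ) (hF₁ : MemLp F₁ 2 μ) :
    ∫ x, (F x - ∫ y, F y ∂μ) ^ 2 ∂μ ≤
      2 * ∫ x, (F₁ x - ∫ y, F₁ y ∂μ) ^ 2 ∂μ + 2 * ∫ x, (F x - F₁ x) ^ 2 ∂μ := by
  have hG : MemLp (fun x => F x - F₁ x) 2 μ := hF.sub hF₁
  set m := ∫ y, F y ∂μ with hm
  set m₁ := ∫ y, F₁ y ∂μ with hm₁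
  set mg := ∫ y, (F y - F₁ y) ∂μ with hmg
  have hmg' : mg = m - m₁ := integral_sub (hF.integrable one_le_two) (hF₁.integrable one_le_two)
  -- the pointwise inequality
  have hpt : ∀ x, (F x - m) ^ 2 ≤ 2 * (F₁ x - m₁) ^ 2 + 2 * ((F x - F₁ x) - mg) ^ 2 := by
    intro x
    have hx : F x - m = (F₁ x - m₁) + ((F x - F₁ x) - mg) := by rw [hmg']; ring
    rw [hx]
    nlinarith [sq_nonneg ((F₁ x - m₁) - ((F x - F₁ x) - mg))]
  -- integrability of the three squares
  have i0 : Integrable (fun x => (F x - m) ^ 2) μ := (hF.sub (memLp_const m)).integrable_sq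
  have i1 : Integrable (fun x => (F₁ x - m₁) ^ 2) μ := (hF₁.sub (memLp_const m₁)).integrable_sq
  have i2 : Integrable (fun x => ((F x - F₁ x) - mg) ^ 2) μ :=
    (hG.sub (memLp_const mg)).integrable_sq
  calc ∫ x, (F x - m) ^ 2 ∂μ
      ≤ ∫ x, (2 * (F₁ x - m₁) ^ 2 + 2 * ((F x - F₁ x) - mg) ^ 2) ∂μ :=
        integral_mono i0 ((i1.const_mul 2).add (i2.const_mul 2)) hpt
    _ = 2 * ∫ x, (F₁ x - m₁) ^ 2 ∂μ + 2 * ∫ x, ((F x - F₁ x) - mg) ^ 2 ∂μ := by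
        rw [integral_add (i1.const_mul 2) (i2.const_mul 2), integral_const_mul,
          integral_const_mul]
    _ ≤ 2 * ∫ x, (F₁ x - m₁) ^ 2 ∂μ + 2 * ∫ x, (F x - F₁ x) ^ 2 ∂μ := by
        have h := integral_sub_average_sq_le hG
        linarith

/-- The bookkeeping of the constants: from `V ≤ 2 V₁ + 2 E`, `V₁ ≤ κ D`, `D / β + E ≤ C R` with
`0 < β`, `0 ≤ D`, `0 ≤ E`, conclude `V ≤ 2 · max(κβ, 1) · C · R`. [folklore] -/
private theorem retention_arith {V V₁ E D κ β C R : ℝ} (hβ : 0 < β) (hD : 0 ≤ D) (hE : 0 ≤ E)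
    (hV : V ≤ 2 * V₁ + 2 * E) (hV₁ : V₁ ≤ κ * D) (hSW : D / β + E ≤ C * R) :
    V ≤ 2 * max (κ * β) 1 * C * R := by
  have hβ0 : β ≠ 0 := hβ.ne'
  have hM1 : 1 ≤ max (κ * β) 1 := le_max_right _ _
  have hM0 : 0 ≤ max (κ * β) 1 := zero_le_one.trans hM1
  have e1 : κ * β * (D / β) = κ * D := by
    rw [div_eq_mul_inv, show κ * β * (D * β⁻¹) = κ * D * (β * β⁻¹) by ring,
      mul_inv_cancel₀ hβ0, mul_one]
  have h1 : κ * D ≤ max (κ * β) 1 * (D / β) :=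
    e1 ▸ mul_le_mul_of_nonneg_right (le_max_left (κ * β) 1) (div_nonneg hD hβ.le)
  have h2 : E ≤ max (κ * β) 1 * E := le_mul_of_one_le_left hE hM1
  have h3 : max (κ * β) 1 * (D / β + E) ≤ max (κ * β) 1 * (C * R) :=
    mul_le_mul_of_nonneg_left hSW hM0
  linarith

/-! ### The stub -/

/-- **L1 `stub_retention_of_smoothWitness`** (crux `ConvexGribovBody.PoincareToGap`, line
`Sketch`): on one torus `(2S+1)⁴` and one slice `s`, with `μ = wilsonMeasure r.ρ β`, `0 < β`:
IF every gauge-invariant link-Lipschitz `f` reading only the time-`s` spatial links `X_s`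
satisfies `Var f ≤ κ · dir_s f`, and every bounded measurable gauge-invariant `F` reading only
`X_s` has an admissible witness `F₁` with
`dir_s F₁ / β + ∫ (F - F₁)² ≤ C · ∫ (F - E_μ[F | X_sᶜ])²`, THEN every bounded measurable
gauge-invariant `F` reading only `X_s` satisfies
`Var F ≤ 2 · max(κβ, 1) · C · ∫ (F - E_μ[F | X_sᶜ])²`.  Proof: `Var F ≤ 2 Var F₁ + 2 ∫ (F - F₁)²`
(`var_le_two_mul_add`), the hypothesis at `F₁`, and `retention_arith`. [folklore] -/
theorem stub_retention_of_smoothWitness :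
    ∀ (G : Type) [Group G] [TopologicalSpace G] [IsTopologicalGroup G] [CompactSpace G]
      [MeasurableSpace G] [BorelSpace G] (r : LatticeRep G) (β κ C : ℝ), 0 < β → ∀ (S : ℕ)
      (μ : Measure (GaugeConfig 4 (2 * S + 1) G)),
      μ = (wilsonMeasure r.ρ β : Measure (GaugeConfig 4 (2 * S + 1) G)) →
    ∀ s : ZMod (2 * S + 1),
    (∀ f : GaugeConfig 4 (2 * S + 1) G → ℝ, IsGaugeInvariant f →
      (∀ U V : GaugeConfig 4 (2 * S + 1) G,
        (∀ e : Edge 4 (2 * S + 1), (e.1 0 - s).val = 0 → e.2 ≠ 0 → U e = V e) → f U = f V) →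
      (∃ K : ℝ, ∀ U V : GaugeConfig 4 (2 * S + 1) G,
        |f U - f V| ≤ K * ∑ e, Real.sqrt (∑ a, ∑ b, ‖(r.ρ (U e) - r.ρ (V e)) a b‖ ^ 2)) →
      ∫ U, (f U - ∫ V, f V ∂μ) ^ 2 ∂μ ≤
        κ * ∑ e : Edge 4 (2 * S + 1), (if (e.1 0 - s).val = 0 ∧ e.2 ≠ 0 then
          ∫ U, (Filter.limsup (fun g : G => |f (Function.update U e g) - f U| /
              Real.sqrt (∑ a, ∑ b, ‖(r.ρ g - r.ρ (U e)) a b‖ ^ 2)) (𝓝[≠] (U e))) ^ 2 ∂μ else 0)) →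
    (∀ F : GaugeConfig 4 (2 * S + 1) G → ℝ, Measurable F → (∃ M : ℝ, ∀ U, |F U| ≤ M) →
      IsGaugeInvariant F → DependsOn F {e : Edge 4 (2 * S + 1) | (e.1 0 - s).val = 0 ∧ e.2 ≠ 0} →
      ∃ F₁ : GaugeConfig 4 (2 * S + 1) G → ℝ, Measurable F₁ ∧ (∃ M : ℝ, ∀ U, |F₁ U| ≤ M) ∧
        IsGaugeInvariant F₁ ∧
        (∀ U V : GaugeConfig 4 (2 * S + 1) G,
          (∀ e : Edge 4 (2 * S + 1), (e.1 0 - s).val = 0 → e.2 ≠ 0 → U e = V e) → F₁ U = F₁ V) ∧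
        (∃ K : ℝ, ∀ U V : GaugeConfig 4 (2 * S + 1) G,
          |F₁ U - F₁ V| ≤ K * ∑ e, Real.sqrt (∑ a, ∑ b, ‖(r.ρ (U e) - r.ρ (V e)) a b‖ ^ 2)) ∧
        (∑ e : Edge 4 (2 * S + 1), (if (e.1 0 - s).val = 0 ∧ e.2 ≠ 0 then
            ∫ U, (Filter.limsup (fun g : G => |F₁ (Function.update U e g) - F₁ U| /
                Real.sqrt (∑ a, ∑ b, ‖(r.ρ g - r.ρ (U e)) a b‖ ^ 2)) (𝓝[≠] (U e))) ^ 2 ∂μ else 0)) / β +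
          ∫ U, (F U - F₁ U) ^ 2 ∂μ ≤
        C * ∫ U, (F U - condExp (cylinderEvents
            {e : Edge 4 (2 * S + 1) | ¬ ((e.1 0 - s).val = 0 ∧ e.2 ≠ 0)}) μ F U) ^ 2 ∂μ) →
    ∀ F : GaugeConfig 4 (2 * S + 1) G → ℝ, Measurable F → (∃ M : ℝ, ∀ U, |F U| ≤ M) →
      IsGaugeInvariant F → DependsOn F {e : Edge 4 (2 * S + 1) | (e.1 0 - s).val = 0 ∧ e.2 ≠ 0} →
    ∫ U, (F U - ∫ V, F V ∂μ) ^ 2 ∂μ ≤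
      2 * max (κ * β) 1 * C * ∫ U, (F U - condExp (cylinderEvents
          {e : Edge 4 (2 * S + 1) | ¬ ((e.1 0 - s).val = 0 ∧ e.2 ≠ 0)}) μ F U) ^ 2 ∂μ := by
  intro G _ _ _ _ _ _ r β κ C hβ S μ hμ s hP hSW F hFm hFb hFg hFd
  -- the witness of `F` and the slice hypothesis at the witness
  obtain ⟨F₁, hF₁m, hF₁b, hF₁g, hF₁d, hF₁l, hF₁sw⟩ := hSW F hFm hFb hFg hFd
  have hV₁ := hP F₁ hF₁g hF₁d hF₁l
  -- `μ` is a probability measure and `F`, `F₁` are in `L²`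
  haveI : IsProbabilityMeasure μ := by
    rw [hμ]
    exact isProbabilityMeasure_wilsonMeasure (d := 4) (L := 2 * S + 1) r.ρ r.continuous β
  obtain ⟨M, hM⟩ := hFb
  obtain ⟨M₁, hM₁⟩ := hF₁b
  have h2F : MemLp F 2 μ :=
    MemLp.of_bound hFm.aestronglyMeasurable M
      (ae_of_all _ fun U => by rw [Real.norm_eq_abs]; exact hM U)
  have h2F₁ : MemLp F₁ 2 μ :=
    MemLp.of_bound hF₁m.aestronglyMeasurable M₁
      (ae_of_all _ fun U => by rw [Real.norm_eq_abs]; exact hM₁ U)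
  have hV := var_le_two_mul_add h2F h2F₁
  refine retention_arith hβ ?_ (integral_nonneg fun U => sq_nonneg _) hV hV₁ hF₁sw
  -- the one-slice Dirichlet form of the witness is nonnegative
  exact Finset.sum_nonneg fun e _ => by
    split_ifs
    · exact integral_nonneg fun U => sq_nonneg _
    · exact le_rfl

end Summit.QuantumFields.YangMills.Theorems.PoincareToGap

end
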